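import Summits.AtomisticToContinuum.BoseEinsteinCondensation.Theorems.BECThomsonPrincipleGDTransferSeededWitnessDefs
import Summits.AtomisticToContinuum.BoseEinsteinCondensation.Theorems.BECThomsonPrincipleGDTransferWindowLaw

/-!
# Route `BECThomsonPrinciple`, crux `GDTransfer` (stmt-AtomisticToContinuum-9482), line `seeded-continuity`:
# stub `stub_weightedWindowLaw` — the window law for the WEIGHTED occupation

The elementary step `TwoSidedDualNorm → WeightedWitnessFamilyFor v → WeightedWindowBoundFor v` of the line
(`Theorems.BECThomsonPrincipleGDTransferSeededWitnessDefs`): verbatim the landed `stub_windowLaw`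
(`Theorems.BECThomsonPrincipleGDTransferWindowLaw`, line `dyson-dressed-witness`) with the occupation
`n_n(Ψ) = cellOccupation (m+1) L (planeWaveMode L n) Ψ.ψ` replaced by the weighted occupation
`weightedOcc m L n Ψ.ψ = N⁻¹‖a₀†a_nΨ‖²`.  The per-mode solve `occ_le_of_mode` (dual norm at tolerance `1` +
(W2)–(W4), the finite common term `gE₀W` cancelled, then `real_perMode`) and the `ℤ³` window count
`windowSum_le_of_pointwise` (`#{0 < ‖n‖_∞ ≤ J} ≤ 26J³`, `Σ ‖n‖_∞⁻² ≤ 26J`, `J = M√ρL/(2π)`) of that file are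
generic in the occupation functional and are reused by name; only the 90-line assembly is re-run.
Constants at `(v, M)`: `ρ₁ := min ρ₀ ρ₁`, `N₁ := max N₀ N₁`,
`K := 26(160π²Cc₁ + 6)M³/(8π³) + 26·40Cc₂M/(2π) + 5γ`.

References: KennedyLiebShastry1988 (J. Stat. Phys. 53, 1019: the `T = 0` infrared bound per mode);
LSSY2005 §1.2.
-/

noncomputable section

open MeasureTheory Filter
open scoped ENNReal NNReal

namespace Summit.AtomisticToContinuum.BoseEinsteinCondensation.Cruxes.GDTransfer.Seeded

open Literature.MathematicalPhysics.QuantumManyBody.BoseGas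
open Summit.AtomisticToContinuum.BoseEinsteinCondensation.Theses.BECThomsonPrinciple
open Summit.AtomisticToContinuum.BoseEinsteinCondensation.Theorems.GaussianDominationCan.Negative
  (InWindow one_le_norm_intVec)
open Summit.AtomisticToContinuum.BoseEinsteinCondensation.Cruxes.GDTransfer.DysonDressedWitness
  (srcPair IsDirection mass eform windowSum TwoSidedDualNorm occ_le_of_mode le_windowSum
    windowSum_le_of_pointwise)

/-- **Registered stub `stub_weightedWindowLaw`** (skeleton v3 of line `seeded-continuity`, crux `GDTransfer`,
stmt-AtomisticToContinuum-9482): `TwoSidedDualNorm → WeightedWitnessFamilyFor v → WeightedWindowBoundFor v`.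
Constants at `(v, M)`: `ρ₁ := min ρ₀ ρ₁`, `N₁ := max N₀ N₁`,
`K := 26(160π²Cc₁ + 6)M³/(8π³) + 26·40Cc₂M/(2π) + 5γ`; at `(m, L)`: `R, δ_B` from the family, `δ_A` from the
dual norm at tolerance `η = 1` and radius `R`, `δ := min δ_A δ_B`.  Per window mode `occ_le_of_mode` gives
`N⁻¹‖a₀†a_nΨ‖² ≤ 160π²Cc₁ + 6 + 40Cc₂ρL²/‖n‖_∞² + 5d(n)`; `windowSum_le_of_pointwise` sums it with
`J³ = M³√ρN/(8π³)`, `ρL²J = M√ρN/(2π)` (`ρL³ = N`). [cite: KennedyLiebShastry1988, the `T = 0` infrared bound] -/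
theorem stub_weightedWindowLaw : Sig.stub_weightedWindowLaw := by
  intro hT v hv hD M hM
  obtain ⟨ρ₀, C, hρ₀, hC, N₀, hA⟩ := hT v hv M hM
  obtain ⟨ρ₁, c₁, c₂, γ, hρ₁, hc₁, hc₂, hγ, N₁, hB⟩ := hD M hM
  -- the constants
  set a : ℝ := 160 * Real.pi ^ 2 * C * c₁ + 6 with ha
  have ha0 : 0 < a := by positivity
  set K : ℝ := 26 * a * M ^ 3 / (8 * Real.pi ^ 3) + 26 * (40 * C * c₂) * M / (2 * Real.pi) + 5 * γ
    with hK
  have hK0 : 0 < K := by positivity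
  refine ⟨min ρ₀ ρ₁, K, lt_min hρ₀ hρ₁, hK0, max N₀ N₁, ?_⟩
  intro m hm L hL hmL hE0
  have hm₀ : N₀ ≤ m + 1 := (le_max_left _ _).trans hm
  have hm₁ : N₁ ≤ m + 1 := (le_max_right _ _).trans hm
  have hL3 : 0 < L ^ 3 := by positivity
  have hmL₀ : ((m + 1 : ℕ) : ℝ) ≤ ρ₀ * L ^ 3 :=
    hmL.trans (mul_le_mul_of_nonneg_right (min_le_left _ _) hL3.le)
  have hmL₁ : ((m + 1 : ℕ) : ℝ) ≤ ρ₁ * L ^ 3 :=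
    hmL.trans (mul_le_mul_of_nonneg_right (min_le_right _ _) hL3.le)
  obtain ⟨R, hR, δB, hδB, hBΨ⟩ := hB m hm₁ L hL hmL₁ hE0
  obtain ⟨δA, hδA, hAΨ⟩ := hA m hm₀ L hL hmL₀ hE0 1 R one_pos hR
  refine ⟨min δA δB, lt_min hδA hδB, fun Ψ hΨ => ?_⟩
  have hΨA : periodicEnergy v Ψ ≤ periodicGroundStateEnergy v (m + 1) L + δA :=
    hΨ.trans (add_le_add le_rfl (min_le_left _ _))
  have hΨB : periodicEnergy v Ψ ≤ periodicGroundStateEnergy v (m + 1) L + δB :=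
    hΨ.trans (add_le_add le_rfl (min_le_right _ _))
  obtain ⟨d, hdsum, hmode⟩ := hBΨ Ψ hΨB
  have hdtop : windowSum M m L d ≠ ⊤ := ne_top_of_le_ne_top ENNReal.ofReal_ne_top hdsum
  -- the per-mode bound
  have hper : ∀ n : Fin 3 → ℤ, n ≠ 0 → InWindow M m L n →
      weightedOcc m L n Ψ.ψ ≤
        ENNReal.ofReal (a + 40 * C * c₂ * (((m + 1 : ℕ) : ℝ) / L ^ 3) * L ^ 2 /
            ‖(fun j => (n j : ℝ))‖ ^ 2) + 5 * d n := by
    intro n hn hwin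
    obtain ⟨ζp, ζm, hζp, hζm, hmp, hmm, hep, hem, hW2, hW3, hW4⟩ := hmode n hn hwin
    have hdual := hAΨ Ψ hΨA n hn hwin ζp ζm hζp hζm hmp hmm hep hem
    have hnpos : 0 < ‖(fun j => (n j : ℝ))‖ := one_pos.trans_le (one_le_norm_intVec hn)
    have hν0 : ‖(fun j => (n j : ℝ))‖ ≠ 0 := hnpos.ne'
    have hL0 : L ≠ 0 := hL.ne'
    have hWtop : mass L ζp + mass L ζm ≠ ⊤ :=
      ne_top_of_le_ne_top (ENNReal.add_ne_top.2 ⟨ENNReal.ofReal_ne_top, ENNReal.ofReal_ne_top⟩)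
        (add_le_add hmp hmm)
    have hdn : d n ≠ ⊤ := ne_top_of_le_ne_top hdtop (le_windowSum d hn hwin)
    have hocc := occ_le_of_mode
      (X := ((m + 1 : ℕ) : ℝ) * ‖srcPair m L n ζp Ψ.ψ + srcPair m L n Ψ.ψ ζm‖)
      (g := 2 * C * L ^ 2 / ‖(fun j => (n j : ℝ))‖ ^ 2)
      (B := c₁ * (2 * Real.pi * ‖(fun j => (n j : ℝ))‖ / L) ^ 2 + c₂ * (((m + 1 : ℕ) : ℝ) / L ^ 3))
      (by positivity) (by positivity) (by positivity) hE0 hWtop hdn hdual hW2 hW3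
      (hW4.trans (by gcongr; exact le_add_self))
    have hid : 20 * (2 * C * L ^ 2 / ‖(fun j => (n j : ℝ))‖ ^ 2 *
          (c₁ * (2 * Real.pi * ‖(fun j => (n j : ℝ))‖ / L) ^ 2 + c₂ * (((m + 1 : ℕ) : ℝ) / L ^ 3))) +
          6 =
        a + 40 * C * c₂ * (((m + 1 : ℕ) : ℝ) / L ^ 3) * L ^ 2 / ‖(fun j => (n j : ℝ))‖ ^ 2 := by
      rw [ha]
      field_simp
      ring
    rw [hid] at hocc
    exact hocc
  -- the window sum of the per-mode bound
  have hb0 : 0 ≤ 40 * C * c₂ * (((m + 1 : ℕ) : ℝ) / L ^ 3) * L ^ 2 := by positivity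
  have hsum := windowSum_le_of_pointwise
    (f := fun p => weightedOcc m L p Ψ.ψ) (d := d) hL hM.le ha0.le hb0 hper
  -- the final algebra: every piece is `const · √ρ · N`
  set N : ℝ := ((m + 1 : ℕ) : ℝ) with hN
  set ρ : ℝ := N / L ^ 3 with hρ
  set s : ℝ := Real.sqrt ρ with hs
  set J : ℝ := M * s * L / (2 * Real.pi) with hJ
  have hNm : N = (m : ℝ) + 1 := Nat.cast_succ m
  have hρ0 : 0 ≤ ρ := by positivity
  have hs0 : 0 ≤ s := Real.sqrt_nonneg _
  have hs2 : s ^ 2 = ρ := Real.sq_sqrt hρ0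
  have hρN : ρ * L ^ 3 = (m : ℝ) + 1 := by
    rw [hρ, hNm]
    field_simp
  have hJ0 : 0 ≤ J := by positivity
  have h26 : 0 ≤ 26 * a * J ^ 3 + 26 * (40 * C * c₂ * ρ * L ^ 2) * J := by positivity
  calc windowSum M m L (fun p => weightedOcc m L p Ψ.ψ)
      ≤ ENNReal.ofReal (26 * a * J ^ 3 + 26 * (40 * C * c₂ * ρ * L ^ 2) * J) +
          5 * windowSum M m L d := hsum
    _ ≤ ENNReal.ofReal (26 * a * J ^ 3 + 26 * (40 * C * c₂ * ρ * L ^ 2) * J) +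
          5 * ENNReal.ofReal (γ * s * (m + 1)) := by gcongr
    _ = ENNReal.ofReal (26 * a * J ^ 3 + 26 * (40 * C * c₂ * ρ * L ^ 2) * J +
          5 * (γ * s * (m + 1))) := by
        rw [← ENNReal.ofReal_ofNat 5, ← ENNReal.ofReal_mul (by norm_num : (0 : ℝ) ≤ 5),
          ← ENNReal.ofReal_add h26 (by positivity)]
    _ = ENNReal.ofReal (K * s * (m + 1)) := by
        congr 1
        rw [hK, hJ]
        linear_combination (26 * a * M ^ 3 * s * L ^ 3 / (8 * Real.pi ^ 3)) * hs2 +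
          (26 * a * M ^ 3 * s / (8 * Real.pi ^ 3) + 26 * (40 * C * c₂) * M * s / (2 * Real.pi)) * hρN

end Summit.AtomisticToContinuum.BoseEinsteinCondensation.Cruxes.GDTransfer.Seeded

end
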